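import Mathlib
import Summits.QuantumFields.QCD.Theorems.QuarksAsStableActionUnquenchedChessboardBoundLinkGramMirror
import Summits.QuantumFields.QCD.Theorems.QuarksAsStableActionUnquenchedChessboardBoundLinkGramSort
import HarnessLib

/-!
# Link Gram identity, part 4: the blocks in the temporal gauge
(crux stmt-QuantumFields-9735, line `Sketch`, lead's stub `linkGram`)

For a field `W` whose temporal links leaving the slice `t = 0` are `1` (temporal gauge on the lower
crossing layer) and a bond set `F` containing that layer:
* `linkJ₁_eq_diagonal`, `linkJ₂_eq_diagonal` — the couplings through the layer are DIAGONAL in the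
  chiral basis: `J₁ = -diag 𝟙[t = 1, α ≥ 2]`, `J₂ = -diag 𝟙[t = 1, α < 2]` (`r = 1`: `(1 ∓ γ'₀)/2`
  are the complementary chiral projections);
* `linkP_eq_mirror` — the lower block is the mirror of the upper block of the reflected field on
  the reflected bond set: `P_F[z] = Γ₀ (Q_{θF}[Θz])ᴴ Γ₀` (`bondWilsonDiracG_chiral_timeReflect`);
* `linkQ_congr` — the upper block only sees the bonds between upper sites.
All statements are proved.
-/

noncomputable section

open Matrix Complex Finset
open Literature.MathematicalPhysics.QuantumFieldTheory Literature.MathematicalPhysics.QuantumLattice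
open Literature.Probability.LatticeModels (TorusSite)
open Summit.QuantumFields.QCD.Theorems.QuarksAsStableAction
open scoped ComplexConjugate BigOperators

namespace Summit.QuantumFields.QCD.Theorems.UnquenchedChessboardBoundLine

/-! ## Time arithmetic of upper sites -/

section Time

variable {L : ℕ} [NeZero L] [Fact (1 < L)]

omit [Fact (1 < L)] in
/-- An upper site with `t = 1` is recovered from its mirror image by the time shift:
`θx + ê₀ = x`. -/
theorem shift_timeReflect_of_val_eq_one {x : TorusSite 4 L} (h1 : (x 0).val = 1) :
    Site.shift (Site.timeReflect x) 0 = x := by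
  have hx1 : x 0 = 1 := by
    rw [← ZMod.natCast_zmod_val (x 0), h1, Nat.cast_one]
  funext k
  by_cases hk : k = 0
  · subst hk
    rw [WilsonRP.shift_apply_self, WilsonRP.timeReflect_apply_zero, hx1]
    ring
  · rw [WilsonRP.shift_apply_of_ne _ hk, WilsonRP.timeReflect_apply_of_ne _ hk]

/-- Time of `θx + ê_μ` for an upper site `x`. -/
theorem val_shift_timeReflect {p : ℕ} {x : TorusSite 4 L} (hx : x ∈ linkUpSites p) (μ : Fin 4) :
    ((Site.shift (Site.timeReflect x) μ) 0).val =
      if μ = 0 then (if (x 0).val = 1 then 1 else if (x 0).val = 2 then 0 else L + 2 - (x 0).val)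
      else (if (x 0).val = 1 then 0 else L + 1 - (x 0).val) := by
  have hv := val_timeReflect_of_mem_linkUpSites hx
  have hx' := mem_linkUpSites.1 hx
  have h1L : 1 < L := Fact.out
  have hlt := ZMod.val_lt (x 0)
  by_cases hμ : μ = 0
  · subst hμ
    rw [if_pos rfl, WilsonRP.val_shift_self, hv]
    by_cases h1 : (x 0).val = 1
    · simp only [if_pos h1]
      rw [if_neg (by omega)]
    · simp only [if_neg h1]
      by_cases h2 : (x 0).val = 2
      · simp only [if_pos h2]
        split_ifs <;> omega
      · simp only [if_neg h2]
        split_ifs <;> omega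
  · rw [if_neg hμ, WilsonRP.val_shift_of_ne _ (Ne.symm hμ), hv]

/-- **Time facts**: for upper sites `x, y` (and `2p + 2 < L`) the mirror image `θx` is never
`y + ê_μ`, `y` is never `θx + ê_k` for spatial `k`, and `y = θx + ê₀` forces `t_x = 1`, `y = x`. -/
theorem linkUp_mirror_facts {p : ℕ} (hL : 2 * p + 2 < L) {x y : TorusSite 4 L}
    (hx : x ∈ linkUpSites p) (hy : y ∈ linkUpSites p) :
    (∀ μ : Fin 4, Site.timeReflect x ≠ Site.shift y μ) ∧
      (∀ μ : Fin 4, μ ≠ 0 → y ≠ Site.shift (Site.timeReflect x) μ) ∧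
      (y = Site.shift (Site.timeReflect x) 0 → (x 0).val = 1 ∧ y = x) := by
  have hvx := val_timeReflect_of_mem_linkUpSites hx
  have hx' := mem_linkUpSites.1 hx
  have hy' := mem_linkUpSites.1 hy
  have hltx := ZMod.val_lt (x 0)
  have hlty := ZMod.val_lt (y 0)
  refine ⟨fun μ h => ?_, fun μ hμ h => ?_, fun h => ?_⟩
  · have hv := congrArg (fun z : TorusSite 4 L => (z 0).val) h
    rw [hvx] at hv
    by_cases hμ : μ = 0
    · subst hμ
      rw [WilsonRP.val_shift_self] at hv
      by_cases h1 : (x 0).val = 1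
      · rw [if_pos h1] at hv
        split_ifs at hv
        omega
      · rw [if_neg h1] at hv
        split_ifs at hv <;> omega
    · rw [WilsonRP.val_shift_of_ne _ (Ne.symm hμ)] at hv
      split_ifs at hv <;> omega
  · have hv := congrArg (fun z : TorusSite 4 L => (z 0).val) h
    rw [val_shift_timeReflect hx μ, if_neg hμ] at hv
    split_ifs at hv <;> omega
  · have hv := congrArg (fun z : TorusSite 4 L => (z 0).val) h
    rw [val_shift_timeReflect hx 0, if_pos rfl] at hv
    have h1 : (x 0).val = 1 := by
      split_ifs at hv with h1 h2 <;> omega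
    exact ⟨h1, by rw [h, shift_timeReflect_of_val_eq_one h1]⟩

end Time

/-! ## The coupling blocks are diagonal -/

section Couplings

variable {L N : ℕ} [NeZero L] [Fact (1 < L)] {G : Type*} [Group G]
  (ρ : G →* Matrix (Fin N) (Fin N) ℂ)

/-- `(1 - γ'₀)_{αβ} = 2·𝟙[α = β, α ≥ 2]`. -/
theorem one_sub_chiralGamma_zero_apply (α β : Fin 4) :
    ((1 : Matrix (Fin 4) (Fin 4) ℂ) - chiralGamma 0) α β =
      if α = β ∧ 2 ≤ (α : ℕ) then 2 else 0 := by
  fin_cases α <;> fin_cases β <;> simp [chiralGamma] <;> norm_num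

/-- `(1 + γ'₀)_{αβ} = 2·𝟙[α = β, α < 2]`. -/
theorem one_add_chiralGamma_zero_apply (α β : Fin 4) :
    ((1 : Matrix (Fin 4) (Fin 4) ℂ) + chiralGamma 0) α β =
      if α = β ∧ (α : ℕ) < 2 then 2 else 0 := by
  fin_cases α <;> fin_cases β <;> simp [chiralGamma] <;> norm_num

/-- **`J₁` is diagonal**: in the temporal gauge on the lower crossing layer (contained in `F`),
`J₁ = -diag 𝟙[t = 1, α ≥ 2]`. -/
theorem linkJ₁_eq_diagonal (p : ℕ) (hL : 2 * p + 2 < L) (F : Finset (Edge 4 L))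
    (hC : ∀ x : TorusSite 4 L, (x 0).val = 0 → (x, (0 : Fin 4)) ∈ F) (W : GaugeConfig 4 L G)
    (hW : ∀ x : TorusSite 4 L, (x 0).val = 0 → W (x, 0) = 1) (m : ℝ) :
    linkJ₁ ρ p F W m =
      diagonal fun i => if ((linkUpEnum L N p i).1.1 0).val = 1 ∧
        2 ≤ ((linkUpEnum L N p i).1.2.2 : ℕ) then -1 else 0 := by
  ext i j
  set u := (linkUpEnum L N p i).1 with hu
  set v := (linkUpEnum L N p j).1 with hv
  have hxu : u.1 ∈ linkUpSites p := (linkUpEnum L N p i).2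
  have hxv : v.1 ∈ linkUpSites p := (linkUpEnum L N p j).2
  obtain ⟨hne, hne', hzero⟩ := linkUp_mirror_facts hL hxu hxv
  simp only [linkJ₁, Matrix.of_apply, diagonal_apply]
  rw [← hu, ← hv, bondWilsonDiracG_apply]
  -- the diagonal entry of `D'` vanishes (mirror of upper ≠ upper)
  have hdiag : ¬ linkMirror u = v := by
    intro h
    have := congrArg Prod.fst h
    simp only [linkMirror] at this
    exact timeReflect_not_mem_of_mem_linkUpSites hL hxv (this ▸ timeReflect_timeReflect_mem_iff.2 hxu)
  rw [if_neg hdiag, zero_sub]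
  -- only the forward temporal hop in direction `0` survives
  rw [Finset.sum_eq_single (0 : Fin 4) ?_ (by simp)]
  swap
  · intro μ _ hμ
    rw [if_neg (fun h => hne' μ hμ h.1), if_neg (fun h => hne μ h.1), add_zero]
  rw [if_neg (show ¬ ((linkMirror u).1 = Site.shift v.1 0 ∧ (v.1, (0 : Fin 4)) ∈ F) from
    fun h => hne 0 h.1), add_zero]
  by_cases hc : v.1 = Site.shift (linkMirror u).1 0
  · obtain ⟨h1, hvu⟩ := hzero hc
    have h0 : ((linkMirror u).1 0).val = 0 := by
      show ((Site.timeReflect u.1) 0).val = 0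
      rw [val_timeReflect_of_mem_linkUpSites hxu, if_pos h1]
    rw [if_pos ⟨hc, hC _ h0⟩, hW _ h0, map_one, Complex.ofReal_one, one_smul]
    simp only [linkMirror]
    by_cases hij : i = j
    · subst hij
      have huv : u = v := by rw [hu, hv]
      rw [if_pos rfl, ← huv, Matrix.one_apply, if_pos (show (linkMirror u).2.1 = u.2.1 from rfl), mul_one,
        one_sub_chiralGamma_zero_apply]
      by_cases h2 : 2 ≤ (u.2.2 : ℕ)
      · rw [if_pos ⟨rfl, h2⟩, if_pos ⟨h1, h2⟩]; norm_num
      · rw [if_neg (fun h => h2 h.2), if_neg (fun h => h2 h.2)]; norm_num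
    · have huv : u ≠ v := by
        intro h
        apply hij
        apply (linkUpEnum L N p).injective
        apply Subtype.ext
        rw [← hu, ← hv]
        exact h
      rw [if_neg hij]
      -- same site, different index: the colour delta or the spin table vanishes
      by_cases hcol : u.2.1 = v.2.1
      · have hspin : u.2.2 ≠ v.2.2 := fun hs => huv (Prod.ext hvu.symm (Prod.ext hcol hs))
        rw [one_sub_chiralGamma_zero_apply, if_neg (fun h => hspin h.1), zero_mul, mul_zero, neg_zero]
      · rw [Matrix.one_apply, if_neg (show ¬ ((linkMirror u).2.1 = v.2.1) from hcol), mul_zero, mul_zero,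
          neg_zero]
  · rw [if_neg (fun h => hc h.1), mul_zero, neg_zero]
    by_cases hij : i = j
    · subst hij
      have huv : u = v := by rw [hu, hv]
      rw [if_pos rfl, if_neg]
      rintro ⟨h1, -⟩
      apply hc
      rw [← huv]
      show u.1 = Site.shift (Site.timeReflect u.1) 0
      rw [shift_timeReflect_of_val_eq_one h1]
    · rw [if_neg hij]

/-- **`J₂` is diagonal**: `J₂ = -diag 𝟙[t = 1, α < 2]`. -/
theorem linkJ₂_eq_diagonal (p : ℕ) (hL : 2 * p + 2 < L) (F : Finset (Edge 4 L))
    (hC : ∀ x : TorusSite 4 L, (x 0).val = 0 → (x, (0 : Fin 4)) ∈ F) (W : GaugeConfig 4 L G)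
    (hW : ∀ x : TorusSite 4 L, (x 0).val = 0 → W (x, 0) = 1) (m : ℝ) :
    linkJ₂ ρ p F W m =
      diagonal fun i => if ((linkUpEnum L N p i).1.1 0).val = 1 ∧
        ((linkUpEnum L N p i).1.2.2 : ℕ) < 2 then -1 else 0 := by
  ext i j
  set u := (linkUpEnum L N p i).1 with hu
  set v := (linkUpEnum L N p j).1 with hv
  have hxu : u.1 ∈ linkUpSites p := (linkUpEnum L N p i).2
  have hxv : v.1 ∈ linkUpSites p := (linkUpEnum L N p j).2
  obtain ⟨hne, hne', hzero⟩ := linkUp_mirror_facts hL hxv hxu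
  simp only [linkJ₂, Matrix.of_apply, diagonal_apply]
  rw [← hu, ← hv, bondWilsonDiracG_apply]
  have hdiag : ¬ u = linkMirror v := by
    intro h
    have := congrArg Prod.fst h
    simp only [linkMirror] at this
    exact timeReflect_not_mem_of_mem_linkUpSites hL hxu (this ▸ timeReflect_timeReflect_mem_iff.2 hxv)
  rw [if_neg hdiag, zero_sub]
  -- only the backward temporal hop in direction `0` survives
  rw [Finset.sum_eq_single (0 : Fin 4) ?_ (by simp)]
  swap
  · intro μ _ hμ
    rw [if_neg (fun h => hne μ h.1), if_neg (fun h => hne' μ hμ h.1), add_zero]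
  rw [if_neg (fun h => hne 0 h.1), zero_add]
  by_cases hc : u.1 = Site.shift (linkMirror v).1 0
  · obtain ⟨h1, huv1⟩ := hzero hc
    have h0 : ((linkMirror v).1 0).val = 0 := by
      show ((Site.timeReflect v.1) 0).val = 0
      rw [val_timeReflect_of_mem_linkUpSites hxv, if_pos h1]
    rw [if_pos ⟨hc, hC _ h0⟩, hW _ h0, inv_one, map_one, Complex.ofReal_one, one_smul]
    simp only [linkMirror]
    by_cases hij : i = j
    · subst hij
      have huv : u = v := by rw [hu, hv]
      have h1' : (u.1 0).val = 1 := by rw [huv]; exact h1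
      rw [if_pos rfl, ← huv, Matrix.one_apply, if_pos (show u.2.1 = (linkMirror u).2.1 from rfl), mul_one,
        one_add_chiralGamma_zero_apply]
      by_cases h2 : (u.2.2 : ℕ) < 2
      · rw [if_pos ⟨rfl, h2⟩, if_pos ⟨h1', h2⟩]; norm_num
      · rw [if_neg (fun h => h2 h.2), if_neg (fun h => h2 h.2)]; norm_num
    · have huv : u ≠ v := by
        intro h
        apply hij
        apply (linkUpEnum L N p).injective
        apply Subtype.ext
        rw [← hu, ← hv]
        exact h
      rw [if_neg hij]
      by_cases hcol : u.2.1 = v.2.1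
      · have hspin : u.2.2 ≠ v.2.2 := fun hs => huv (Prod.ext huv1 (Prod.ext hcol hs))
        rw [one_add_chiralGamma_zero_apply, if_neg (fun h => hspin h.1), zero_mul, mul_zero, neg_zero]
      · rw [Matrix.one_apply, if_neg (show ¬ (u.2.1 = (linkMirror v).2.1) from hcol), mul_zero, mul_zero,
          neg_zero]
  · rw [if_neg (fun h => hc h.1), mul_zero, neg_zero]
    by_cases hij : i = j
    · subst hij
      have huv : u = v := by rw [hu, hv]
      rw [if_pos rfl, if_neg]
      rintro ⟨h1, -⟩
      apply hc
      rw [huv]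
      show v.1 = Site.shift (Site.timeReflect v.1) 0
      rw [shift_timeReflect_of_val_eq_one (huv ▸ h1)]
    · rw [if_neg hij]

end Couplings

/-! ## The lower block is the mirror of an upper block -/

section Mirror

variable {L N : ℕ} [NeZero L] [Fact (1 < L)] {G : Type*} [Group G]
  (ρ : G →* Matrix (Fin N) (Fin N) ℂ)

omit [NeZero L] [Fact (1 < L)] in
/-- `Θ` is an involution on gauge configurations (stated as `Function.Involutive`; the pointwise
form exists in the YangMills tree as `…Reconstructible.timeReflect_timeReflect_config`). -/
theorem timeReflect_involutive_cfg :
    Function.Involutive (GaugeConfig.timeReflect : GaugeConfig 4 L G → GaugeConfig 4 L G) := by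
  intro U
  funext e
  rw [WilsonRP.timeReflect_apply, WilsonRP.timeReflect_apply]
  have h2 : (WilsonRP.edgeReflect e).2 = e.2 := by
    unfold WilsonRP.edgeReflect
    split_ifs with h <;> simp [h]
  rw [h2]
  split_ifs with h
  · rw [WilsonRP.edgeReflect_edgeReflect, inv_inv]
  · rw [WilsonRP.edgeReflect_edgeReflect]

omit [Fact (1 < L)] in
/-- **The lower block is a mirror**: `P_F[z] = Γ₀ (Q_{θF}[Θz])ᴴ Γ₀` with `Γ₀ = diag(γ'₀ αα)` and
`θF = F.image edgeReflect` (unitary `ρ`). -/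
theorem linkP_eq_mirror (hρ : ∀ g, ρ g ∈ Matrix.unitaryGroup (Fin N) ℂ) (p : ℕ)
    (F : Finset (Edge 4 L)) (z : GaugeConfig 4 L G) (m : ℝ) :
    linkP ρ p F z m =
      diagonal (fun i => chiralGamma 0 (linkUpEnum L N p i).1.2.2 (linkUpEnum L N p i).1.2.2) *
        (linkQ ρ p (F.image WilsonRP.edgeReflect) z.timeReflect m)ᴴ *
        diagonal (fun i => chiralGamma 0 (linkUpEnum L N p i).1.2.2 (linkUpEnum L N p i).1.2.2) := by
  ext i j
  rw [Matrix.mul_apply, Finset.sum_eq_single j, diagonal_apply_eq, Matrix.mul_apply,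
    Finset.sum_eq_single i, diagonal_apply_eq, conjTranspose_apply]
  · simp only [linkP, linkQ, Matrix.of_apply, Complex.star_def]
    have hinj : Function.Injective (WilsonRP.edgeReflect (d := 4) (L := L)) :=
      Function.Involutive.injective WilsonRP.edgeReflect_edgeReflect
    rw [bondWilsonDiracG_chiral_timeReflect ρ hρ Site.timeReflect
      (fun x => WilsonRP.timeReflect_timeReflect x) timeReflect_eq_shift_iff
      (fun x k hk => WilsonRP.timeReflect_shift_of_ne x hk) (E := F.image WilsonRP.edgeReflect) (E' := F)
      ?_ ?_ z.timeReflect z ?_ ?_ m 1]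
    · simp only [linkMirror, WilsonRP.timeReflect_timeReflect]
      ring
    · intro x y hy
      rw [Finset.mem_image]
      constructor
      · intro h
        exact ⟨(x, 0), h, by unfold WilsonRP.edgeReflect; simp [hy]⟩
      · rintro ⟨e, he, hee⟩
        have : e = (x, 0) := by
          apply hinj
          rw [hee]
          unfold WilsonRP.edgeReflect
          simp [hy]
        exact this ▸ he
    · intro x k hk
      rw [Finset.mem_image]
      constructor
      · intro h
        exact ⟨(x, k), h, by unfold WilsonRP.edgeReflect; simp [hk]⟩
      · rintro ⟨e, he, hee⟩
        have : e = (x, k) := by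
          apply hinj
          rw [hee]
          unfold WilsonRP.edgeReflect
          simp [hk]
        exact this ▸ he
    · intro x
      rw [WilsonRP.timeReflect_apply, if_pos rfl, inv_inv]
      unfold WilsonRP.edgeReflect
      simp
    · intro x k hk
      rw [WilsonRP.timeReflect_apply, if_neg hk]
      unfold WilsonRP.edgeReflect
      simp [hk]
  · intro k _ hk; rw [diagonal_apply_ne _ (Ne.symm hk), zero_mul]
  · simp
  · intro k _ hk; rw [diagonal_apply_ne _ hk, mul_zero]
  · simp

omit [Fact (1 < L)] in
/-- **The upper block only sees the bonds between upper sites.** -/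
theorem linkQ_congr (p : ℕ) {F₁ F₂ : Finset (Edge 4 L)}
    (h : ∀ b : Edge 4 L, b.1 ∈ linkUpSites p → b.1.shift b.2 ∈ linkUpSites p → (b ∈ F₁ ↔ b ∈ F₂))
    (W : GaugeConfig 4 L G) (m : ℝ) : linkQ ρ p F₁ W m = linkQ ρ p F₂ W m := by
  ext i j
  simp only [linkQ, Matrix.of_apply, bondWilsonDiracG_apply]
  set u := (linkUpEnum L N p i).1
  set v := (linkUpEnum L N p j).1
  have hxu : u.1 ∈ linkUpSites p := (linkUpEnum L N p i).2
  have hxv : v.1 ∈ linkUpSites p := (linkUpEnum L N p j).2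
  congr 1
  congr 1
  refine Finset.sum_congr rfl fun μ _ => ?_
  congr 1
  · by_cases hc : v.1 = Site.shift u.1 μ
    · have hm := h (u.1, μ) hxu (hc ▸ hxv)
      simp only [hc, true_and, hm]
    · rw [if_neg (fun h' => hc h'.1), if_neg (fun h' => hc h'.1)]
  · by_cases hc : u.1 = Site.shift v.1 μ
    · have hm := h (v.1, μ) hxv (hc ▸ hxu)
      simp only [hc, true_and, hm]
    · rw [if_neg (fun h' => hc h'.1), if_neg (fun h' => hc h'.1)]

end Mirror

end Summit.QuantumFields.QCD.Theorems.UnquenchedChessboardBoundLine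

end
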